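import Literature.Topology.FourManifolds.ClosedBallProofs
import HarnessLib

/-!
# Smooth maps into and out of the closed ball `𝔻ⁿ⁺¹` (manifold with boundary)

Third file on the closed unit ball `𝔻ⁿ⁺¹ ⊆ ℝⁿ⁺¹` with its manifold-with-boundary structure
`Literature.Topology.FourManifolds.instChartedSpaceClosedBall` (`ClosedBall.lean`, model `𝓡∂ (n + 1)`; interior chart the
translation `x ↦ x + 2e₀`, boundary charts `x ↦ (1 - ‖x‖, σ (x/‖x‖))`). `ClosedBallProofs.lean`
proved that specific maps *out of* `𝔻ⁿ⁺¹` (the hemisphere embeddings) are smooth by exhibiting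
immersion charts; here we set up the general-purpose calculus that the tree lacked:

* `Literature.Topology.FourManifolds.contMDiff_coe_closedBall`: the inclusion `𝔻ⁿ⁺¹ ↪ ℝⁿ⁺¹` is `C^∞`
  (models `𝓡∂ (n + 1)`, `𝓘(ℝ, ℝⁿ⁺¹)`);
* `ContMDiffAt.codRestrict_closedBall`, `ContMDiff.codRestrict_closedBall` (root namespace, like
  Mathlib's `ContMDiff.codRestrict_sphere`; also `ContMDiff.comp_coe_closedBall`): a map
  `f : M → ℝⁿ⁺¹` from any manifold (with or without boundary), `C^∞` as a map into `ℝⁿ⁺¹` and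
  with values in `𝔻ⁿ⁺¹`, is `C^∞` as a map into the manifold with boundary `𝔻ⁿ⁺¹`;
* `Literature.Topology.FourManifolds.contMDiff_closedBall_mk`: hence the restriction `𝔻ⁿ⁺¹ → 𝔻ᵐ⁺¹` of an ambient `C^∞` map
  `F : ℝⁿ⁺¹ → ℝᵐ⁺¹` with `F(𝔻ⁿ⁺¹) ⊆ 𝔻ᵐ⁺¹` is `C^∞` for the structures with boundary;
* `Literature.Topology.FourManifolds.Diffeomorph.closedBallRestrict`: an ambient diffeomorphism of `ℝⁿ⁺¹` preserving `𝔻ⁿ⁺¹`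
  (in both directions) restricts to a self-diffeomorphism of `𝔻ⁿ⁺¹`; in particular
  `Literature.closedBallCongr A` for a linear isometry `A` of `ℝⁿ⁺¹`, which on the boundary sphere is
  the diffeomorphism `Literature.sphereCongr A` of `𝕊ⁿ` (`Literature.Topology.FourManifolds.closedBallCongr_inclusion`); the
  reflection `Literature.sphereReflection v` of `ClosedBallProofs.lean` is `sphereCongr` of Mathlib's
  `Submodule.reflection` (`Literature.Topology.FourManifolds.sphereReflection_eq_sphereCongr`).

These are the elementary facts "smoothness of a map into a regular domain `D ⊆ ℝᵏ` can be
tested in `ℝᵏ`" and "restrictions of ambient smooth maps to `D` are smooth" (Lee, *Introduction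
to Smooth Manifolds*, 2nd ed. (2013), Ch. 1, smooth structure on `𝔹̄ⁿ`, Problem 1-11, and Ch. 5,
regular domains, Prop. 5.46–5.47; Hirsch, *Differential Topology* (1976), §1.4). The proofs read
the maps in the explicit charts: the boundary chart at `p` is the restriction of the ambient
*polar chart* `polarChart p` of `ClosedBallProofs.lean`, a partial diffeomorphism of `ℝⁿ⁺¹`
(`contDiffOn_polarChart`, `contDiff_polarChart_symm`), and the interior chart is the restriction
of a translation. Consumers: extension of diffeomorphisms of `𝕊ⁿ` over `𝔻ⁿ⁺¹`
(`Literature.Topology.FourManifolds.ExtendsOverBall`, `CerfGammaFourProofs.lean`; Akbulut's `Literature.Topology.FourManifolds.ExtendsToDiffeomorph`,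
`Corks.lean`), starting with linear isometries.

## References

* J. M. Lee, *Introduction to Smooth Manifolds*, 2nd ed., GTM 218, Springer (2013), Ch. 1
  (Problem 1-11), Ch. 5 (Prop. 5.46, 5.47).
* M. W. Hirsch, *Differential Topology*, GTM 33, Springer (1976), §1.4.
-/

open scoped Manifold ContDiff Topology
open Set Function Metric

noncomputable section

namespace Literature.Topology.FourManifolds

/-- Local notation: `𝔼 n` is the model Euclidean space `EuclideanSpace ℝ (Fin n)`. -/
local notation "𝔼 " n:arg => EuclideanSpace ℝ (Fin n)

/-- Local notation: `𝕊 n` is the unit sphere in `EuclideanSpace ℝ (Fin (n + 1))`. -/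
local notation "𝕊 " n:arg => (Metric.sphere (0 : EuclideanSpace ℝ (Fin (n + 1))) 1)

/-- Local notation: `𝔻 n` is the closed unit ball in `EuclideanSpace ℝ (Fin n)`. -/
local notation "𝔻 " n:arg => (Metric.closedBall (0 : EuclideanSpace ℝ (Fin n)) 1)

attribute [local instance] fact_finrank_euclideanSpace_succ

variable {n : ℕ}

/-! ### The boundary charts are restrictions of the polar charts -/

/-- The boundary chart of `𝔻ⁿ⁺¹` at `p` is the restriction of the ambient polar chart at `p`
(definitional: same formula). [folklore] -/
theorem coe_closedBallBoundaryChart_eq_polarChart (p : 𝕊 n) (x : 𝔻 (n + 1)) :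
    (closedBallBoundaryChart p x).val = polarChart p (x : 𝔼 (n + 1)) :=
  rfl

/-- The source of the boundary chart at `p` is the trace on `𝔻ⁿ⁺¹` of the source of the polar
chart at `p` (definitional). [folklore] -/
theorem mem_closedBallBoundaryChart_source_iff (p : 𝕊 n) (x : 𝔻 (n + 1)) :
    x ∈ (closedBallBoundaryChart p).source ↔ (x : 𝔼 (n + 1)) ∈ (polarChart p).source :=
  Iff.rfl

/-- A point `p` of the unit sphere lies in the source of the polar chart at the direction `p`.
[folklore] -/
theorem mem_polarChart_source_self (p : 𝕊 n) : (p : 𝔼 (n + 1)) ∈ (polarChart p).source := by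
  refine ⟨ne_zero_of_mem_unit_sphere p, ?_⟩
  rw [norm_eq_of_mem_sphere, inv_one, one_smul, ← coe_neg_sphere]
  exact fun h => ne_neg_of_mem_unit_sphere ℝ p (Subtype.ext h)

/-! ### Maps out of the closed ball: the inclusion into `ℝⁿ⁺¹` is smooth -/

/-- **The inclusion `𝔻ⁿ⁺¹ ↪ ℝⁿ⁺¹` is `C^∞`** for the manifold-with-boundary structure of
`𝔻ⁿ⁺¹` (model `𝓡∂ (n + 1)`) and the vector space `ℝⁿ⁺¹`. Near an interior point it reads
`z ↦ z - 2e₀` after the (extended) interior chart, near a boundary point `(polarChart p)⁻¹`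
after the (extended) boundary chart at `p`; both are `C^∞` on `ℝⁿ⁺¹`, and extended charts are
`C^∞` (`OpenPartialHomeomorph.contMDiffAt_extend`). Lee (2013), Ch. 1 (Problem 1-11) and
Prop. 5.46. [folklore] -/
theorem contMDiff_coe_closedBall :
    ContMDiff (𝓡∂ (n + 1)) 𝓘(ℝ, 𝔼 (n + 1)) ∞ (Subtype.val : (𝔻 (n + 1)) → 𝔼 (n + 1)) := by
  intro x
  by_cases hx : ‖(x : 𝔼 (n + 1))‖ < 1
  · have he : closedBallInteriorChart n ∈ IsManifold.maximalAtlas (𝓡∂ (n + 1)) ∞ (𝔻 (n + 1)) :=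
      IsManifold.subset_maximalAtlas (mem_insert _ _)
    have h1 : ContMDiffAt (𝓡∂ (n + 1)) 𝓘(ℝ, 𝔼 (n + 1)) ∞
        ((closedBallInteriorChart n).extend (𝓡∂ (n + 1))) x :=
      (closedBallInteriorChart n).contMDiffAt_extend he (by simpa using hx)
    have h2 : ContMDiffAt 𝓘(ℝ, 𝔼 (n + 1)) 𝓘(ℝ, 𝔼 (n + 1)) ∞
        (fun z : 𝔼 (n + 1) => z - (2 : ℝ) • closedBallBaseVector n)
        ((closedBallInteriorChart n).extend (𝓡∂ (n + 1)) x) :=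
      (contDiff_id.sub contDiff_const).contDiffAt.contMDiffAt
    refine (h2.comp x h1).congr_of_eventuallyEq (Filter.Eventually.of_forall fun y => ?_)
    simp only [comp_apply, OpenPartialHomeomorph.extend_coe,
      modelWithCornersEuclideanHalfSpace_apply, coe_closedBallInteriorChart_apply,
      add_sub_cancel_right]
  · have hx1 : ‖(x : 𝔼 (n + 1))‖ = 1 := (mem_closedBall_zero_iff.1 x.2).antisymm (not_lt.1 hx)
    set p : 𝕊 n := ⟨x, mem_sphere_zero_iff_norm.2 hx1⟩ with hp
    have hxs : x ∈ (closedBallBoundaryChart p).source :=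
      (mem_closedBallBoundaryChart_source_iff p x).2 (mem_polarChart_source_self p)
    have he : closedBallBoundaryChart p ∈ IsManifold.maximalAtlas (𝓡∂ (n + 1)) ∞ (𝔻 (n + 1)) :=
      IsManifold.subset_maximalAtlas (mem_insert_of_mem _ (mem_range_self p))
    have h1 : ContMDiffAt (𝓡∂ (n + 1)) 𝓘(ℝ, 𝔼 (n + 1)) ∞
        ((closedBallBoundaryChart p).extend (𝓡∂ (n + 1))) x :=
      (closedBallBoundaryChart p).contMDiffAt_extend he hxs
    have h2 : ContMDiffAt 𝓘(ℝ, 𝔼 (n + 1)) 𝓘(ℝ, 𝔼 (n + 1)) ∞ (polarChart p).symm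
        ((closedBallBoundaryChart p).extend (𝓡∂ (n + 1)) x) :=
      (contDiff_polarChart_symm p).contDiffAt.contMDiffAt
    refine (h2.comp x h1).congr_of_eventuallyEq ?_
    filter_upwards [(closedBallBoundaryChart p).open_source.mem_nhds hxs] with y hy
    rw [comp_apply, OpenPartialHomeomorph.extend_coe, comp_apply,
      modelWithCornersEuclideanHalfSpace_apply, coe_closedBallBoundaryChart_eq_polarChart,
      (polarChart p).left_inv ((mem_closedBallBoundaryChart_source_iff p y).1 hy)]

/-- Smooth maps out of `𝔻ⁿ⁺¹` composed with the inclusion: if `g : ℝⁿ⁺¹ → N` is `C^∞` then so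
is its restriction to `𝔻ⁿ⁺¹`. [folklore] -/
theorem _root_.ContMDiff.comp_coe_closedBall {EN : Type*} [NormedAddCommGroup EN] [NormedSpace ℝ EN]
    {HN : Type*} [TopologicalSpace HN] {J : ModelWithCorners ℝ EN HN} {N : Type*}
    [TopologicalSpace N] [ChartedSpace HN N] {g : 𝔼 (n + 1) → N}
    (hg : ContMDiff 𝓘(ℝ, 𝔼 (n + 1)) J ∞ g) :
    ContMDiff (𝓡∂ (n + 1)) J ∞ (fun x : 𝔻 (n + 1) => g x) :=
  hg.comp contMDiff_coe_closedBall

/-! ### Maps into the closed ball: smoothness is tested in `ℝⁿ⁺¹` -/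

section Into

variable {EM : Type*} [NormedAddCommGroup EM] [NormedSpace ℝ EM] {HM : Type*}
  [TopologicalSpace HM] {I : ModelWithCorners ℝ EM HM} {M : Type*} [TopologicalSpace M]
  [ChartedSpace HM M]

/-- **Maps into `𝔻ⁿ⁺¹` are smooth when they are smooth into `ℝⁿ⁺¹`** (pointwise version). If
`f : M → ℝⁿ⁺¹` is `C^∞` at `x` as a map into the vector space and takes values in `𝔻ⁿ⁺¹`,
then the induced map `M → 𝔻ⁿ⁺¹` is `C^∞` at `x` for the manifold-with-boundary structure of
`𝔻ⁿ⁺¹`: composed with the extended chart at `f x` it is `f + 2e₀` (interior chart) or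
`polarChart p ∘ f` (boundary chart, `p = f x`), and `polarChart p` is `C^∞` near `p`.
Lee (2013), Prop. 5.47 with Problem 1-11 (regular domains). [folklore] -/
theorem _root_.ContMDiffAt.codRestrict_closedBall {f : M → 𝔼 (n + 1)} {x : M}
    (hf : ContMDiffAt I 𝓘(ℝ, 𝔼 (n + 1)) ∞ f x) (h𝔻 : ∀ y, f y ∈ 𝔻 (n + 1)) :
    ContMDiffAt I (𝓡∂ (n + 1)) ∞ (Set.codRestrict f (𝔻 (n + 1)) h𝔻) x := by
  rw [contMDiffAt_iff_target]
  refine ⟨Topology.IsInducing.subtypeVal.continuousAt_iff.2 hf.continuousAt, ?_⟩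
  by_cases hx : ‖f x‖ < 1
  · have key : extChartAt (𝓡∂ (n + 1)) (Set.codRestrict f (𝔻 (n + 1)) h𝔻 x) ∘
        Set.codRestrict f (𝔻 (n + 1)) h𝔻 = fun y => f y + (2 : ℝ) • closedBallBaseVector n := by
      funext y
      rw [extChartAt, closedBall_chartAt_of_norm_lt_one (by exact hx)]
      rfl
    rw [key]
    exact hf.add contMDiffAt_const
  · have hx1 : ‖f x‖ = 1 := (mem_closedBall_zero_iff.1 (h𝔻 x)).antisymm (not_lt.1 hx)
    set p : 𝕊 n := ⟨f x, mem_sphere_zero_iff_norm.2 hx1⟩ with hp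
    have key : extChartAt (𝓡∂ (n + 1)) (Set.codRestrict f (𝔻 (n + 1)) h𝔻 x) ∘
        Set.codRestrict f (𝔻 (n + 1)) h𝔻 = polarChart p ∘ f := by
      funext y
      rw [extChartAt, closedBall_chartAt_of_norm_eq_one (by exact hx1)]
      rfl
    rw [key]
    exact ((contDiffOn_polarChart p).contDiffAt ((polarChart p).open_source.mem_nhds
      (mem_polarChart_source_self p))).contMDiffAt.comp x hf

/-- **Maps into `𝔻ⁿ⁺¹` are smooth when they are smooth into `ℝⁿ⁺¹`.** Lee (2013), Prop. 5.47
with Problem 1-11. [folklore] -/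
theorem _root_.ContMDiff.codRestrict_closedBall {f : M → 𝔼 (n + 1)}
    (hf : ContMDiff I 𝓘(ℝ, 𝔼 (n + 1)) ∞ f) (h𝔻 : ∀ y, f y ∈ 𝔻 (n + 1)) :
    ContMDiff I (𝓡∂ (n + 1)) ∞ (Set.codRestrict f (𝔻 (n + 1)) h𝔻) := fun x =>
  ContMDiffAt.codRestrict_closedBall (hf x) h𝔻

end Into

/-! ### Restrictions of ambient smooth maps -/

/-- **Restriction of an ambient smooth map to closed balls.** If `F : ℝⁿ⁺¹ → ℝᵐ⁺¹` is `C^∞` and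
maps `𝔻ⁿ⁺¹` into `𝔻ᵐ⁺¹`, the induced map `𝔻ⁿ⁺¹ → 𝔻ᵐ⁺¹` is `C^∞` for the structures with
boundary. Lee (2013), Ch. 1 (Problem 1-11), Prop. 5.46–5.47. [folklore] -/
theorem contMDiff_closedBall_mk {m : ℕ} {F : 𝔼 (n + 1) → 𝔼 (m + 1)} (hF : ContDiff ℝ ∞ F)
    (h : ∀ x : 𝔻 (n + 1), F x ∈ 𝔻 (m + 1)) :
    ContMDiff (𝓡∂ (n + 1)) (𝓡∂ (m + 1)) ∞ (fun x : 𝔻 (n + 1) => (⟨F x, h x⟩ : 𝔻 (m + 1))) :=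
  ContMDiff.codRestrict_closedBall (ContMDiff.comp_coe_closedBall hF.contMDiff) h

/-- Restriction of an ambient smooth map, `Set.MapsTo.restrict` form. [folklore] -/
theorem contMDiff_mapsTo_restrict_closedBall {m : ℕ} {F : 𝔼 (n + 1) → 𝔼 (m + 1)}
    (hF : ContDiff ℝ ∞ F) (h : MapsTo F (𝔻 (n + 1)) (𝔻 (m + 1))) :
    ContMDiff (𝓡∂ (n + 1)) (𝓡∂ (m + 1)) ∞ (h.restrict F (𝔻 (n + 1)) (𝔻 (m + 1))) :=
  contMDiff_closedBall_mk hF fun x => h x.2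

/-- **An ambient diffeomorphism preserving the closed ball restricts to a diffeomorphism of the
closed ball** (as a manifold with boundary). [folklore] -/
def Diffeomorph.closedBallRestrict
    (Φ : 𝔼 (n + 1) ≃ₘ⟮𝓘(ℝ, 𝔼 (n + 1)), 𝓘(ℝ, 𝔼 (n + 1))⟯ 𝔼 (n + 1))
    (h : MapsTo Φ (𝔻 (n + 1)) (𝔻 (n + 1))) (h' : MapsTo Φ.symm (𝔻 (n + 1)) (𝔻 (n + 1))) :
    (𝔻 (n + 1)) ≃ₘ⟮𝓡∂ (n + 1), 𝓡∂ (n + 1)⟯ (𝔻 (n + 1)) where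
  toFun x := ⟨Φ x, h x.2⟩
  invFun y := ⟨Φ.symm y, h' y.2⟩
  left_inv x := Subtype.ext (Φ.symm_apply_apply x)
  right_inv y := Subtype.ext (Φ.apply_symm_apply y)
  contMDiff_toFun := contMDiff_closedBall_mk (contMDiff_iff_contDiff.1 Φ.contMDiff) fun x => h x.2
  contMDiff_invFun :=
    contMDiff_closedBall_mk (contMDiff_iff_contDiff.1 Φ.symm.contMDiff) fun y => h' y.2

/-- The restricted diffeomorphism in coordinates (definitional). [folklore] -/
@[simp]
theorem Diffeomorph.coe_closedBallRestrict
    (Φ : 𝔼 (n + 1) ≃ₘ⟮𝓘(ℝ, 𝔼 (n + 1)), 𝓘(ℝ, 𝔼 (n + 1))⟯ 𝔼 (n + 1))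
    (h : MapsTo Φ (𝔻 (n + 1)) (𝔻 (n + 1))) (h' : MapsTo Φ.symm (𝔻 (n + 1)) (𝔻 (n + 1)))
    (x : 𝔻 (n + 1)) :
    ((Diffeomorph.closedBallRestrict Φ h h' x : 𝔻 (n + 1)) : 𝔼 (n + 1)) = Φ x :=
  rfl

/-! ### Linear isometries act on the closed ball and on its boundary sphere -/

/-- A linear isometry maps the closed unit ball into itself. [folklore] -/
theorem linearIsometryEquiv_mem_closedBall (A : 𝔼 (n + 1) ≃ₗᵢ[ℝ] 𝔼 (n + 1)) (x : 𝔻 (n + 1)) :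
    A x ∈ 𝔻 (n + 1) := by
  rw [mem_closedBall_zero_iff, LinearIsometryEquiv.norm_map]
  exact mem_closedBall_zero_iff.1 x.2

/-- **A linear isometry of `ℝⁿ⁺¹` restricted to the closed unit ball**, as a self-diffeomorphism
of the manifold with boundary `𝔻ⁿ⁺¹`. [folklore] -/
def closedBallCongr (A : 𝔼 (n + 1) ≃ₗᵢ[ℝ] 𝔼 (n + 1)) :
    (𝔻 (n + 1)) ≃ₘ⟮𝓡∂ (n + 1), 𝓡∂ (n + 1)⟯ (𝔻 (n + 1)) where
  toFun x := ⟨A x, linearIsometryEquiv_mem_closedBall A x⟩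
  invFun y := ⟨A.symm y, linearIsometryEquiv_mem_closedBall A.symm y⟩
  left_inv x := Subtype.ext (A.symm_apply_apply x)
  right_inv y := Subtype.ext (A.apply_symm_apply y)
  contMDiff_toFun := contMDiff_closedBall_mk A.contDiff (linearIsometryEquiv_mem_closedBall A)
  contMDiff_invFun :=
    contMDiff_closedBall_mk A.symm.contDiff (linearIsometryEquiv_mem_closedBall A.symm)

/-- The action of a linear isometry on `𝔻ⁿ⁺¹` in coordinates (definitional). [folklore] -/
@[simp]
theorem coe_closedBallCongr (A : 𝔼 (n + 1) ≃ₗᵢ[ℝ] 𝔼 (n + 1)) (x : 𝔻 (n + 1)) :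
    ((closedBallCongr A x : 𝔻 (n + 1)) : 𝔼 (n + 1)) = A x :=
  rfl

/-- The inverse of `closedBallCongr A` is `closedBallCongr A⁻¹`. [folklore] -/
theorem closedBallCongr_symm (A : 𝔼 (n + 1) ≃ₗᵢ[ℝ] 𝔼 (n + 1)) :
    (closedBallCongr A).symm = closedBallCongr A.symm :=
  rfl

/-- **A linear isometry of `ℝⁿ⁺¹` restricted to the unit sphere**, as a self-diffeomorphism of
Mathlib's analytic manifold `𝕊ⁿ` (`ContMDiff.codRestrict_sphere`, `contMDiff_coe_sphere`).
[folklore] -/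
def sphereCongr (A : 𝔼 (n + 1) ≃ₗᵢ[ℝ] 𝔼 (n + 1)) : (𝕊 n) ≃ₘ⟮𝓡 n, 𝓡 n⟯ (𝕊 n) where
  toFun := Set.codRestrict (fun y : 𝕊 n => A y) _ fun y => by simp [norm_eq_of_mem_sphere]
  invFun := Set.codRestrict (fun y : 𝕊 n => A.symm y) _ fun y => by simp [norm_eq_of_mem_sphere]
  left_inv y := Subtype.ext (A.symm_apply_apply y)
  right_inv y := Subtype.ext (A.apply_symm_apply y)
  contMDiff_toFun :=
    ContMDiff.codRestrict_sphere (A.contDiff.contMDiff.comp contMDiff_coe_sphere) _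
  contMDiff_invFun :=
    ContMDiff.codRestrict_sphere (A.symm.contDiff.contMDiff.comp contMDiff_coe_sphere) _

/-- The action of a linear isometry on `𝕊ⁿ` in coordinates (definitional). [folklore] -/
@[simp]
theorem coe_sphereCongr (A : 𝔼 (n + 1) ≃ₗᵢ[ℝ] 𝔼 (n + 1)) (y : 𝕊 n) :
    ((sphereCongr A y : 𝕊 n) : 𝔼 (n + 1)) = A y :=
  rfl

/-- The inverse of `sphereCongr A` is `sphereCongr A⁻¹`. [folklore] -/
theorem sphereCongr_symm (A : 𝔼 (n + 1) ≃ₗᵢ[ℝ] 𝔼 (n + 1)) :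
    (sphereCongr A).symm = sphereCongr A.symm :=
  rfl

/-- **`closedBallCongr A` extends `sphereCongr A`**: on the boundary sphere `𝕊ⁿ = ∂𝔻ⁿ⁺¹`
(included by `Set.inclusion`, the map `(closedBallBoundaryData n).incl`) the two actions of a
linear isometry agree. [folklore] -/
theorem closedBallCongr_inclusion (A : 𝔼 (n + 1) ≃ₗᵢ[ℝ] 𝔼 (n + 1)) (z : 𝕊 n) :
    closedBallCongr A (Set.inclusion sphere_subset_closedBall z) =
      Set.inclusion sphere_subset_closedBall (sphereCongr A z) :=
  rfl

/-- The reflection diffeomorphism `sphereReflection v` of `ClosedBallProofs.lean` is the action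
`sphereCongr` of Mathlib's hyperplane reflection `Submodule.reflection (ℝ ∙ v)ᗮ`. [folklore] -/
theorem sphereReflection_eq_sphereCongr {m : ℕ} (v : 𝕊 m) :
    sphereReflection v = sphereCongr ((ℝ ∙ (v : 𝔼 (m + 1)))ᗮ.reflection) :=
  Diffeomorph.ext fun _ => rfl

/-- Hence every hyperplane reflection of `𝕊ⁿ` extends to a diffeomorphism of `𝔻ⁿ⁺¹`, namely
`closedBallCongr` of the ambient reflection. [folklore] -/
theorem closedBallCongr_reflection_inclusion (v z : 𝕊 n) :
    closedBallCongr ((ℝ ∙ (v : 𝔼 (n + 1)))ᗮ.reflection)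
        (Set.inclusion sphere_subset_closedBall z) =
      Set.inclusion sphere_subset_closedBall (sphereReflection v z) :=
  rfl

end Literature.Topology.FourManifolds

end
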